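import Literature.Analysis.FluidPDE.OnsagerBDSVPerturbation
import Literature.Analysis.FluidPDE.OnsagerBDSVStressSplit
import Literature.Analysis.FluidPDE.DeRosaPertStressErrors
import Literature.Analysis.FluidPDE.DeRosaPertTransportErrorProof
import Literature.Analysis.FluidPDE.DeRosaPerturbation
import HarnessLib

/-!
# De Rosa's perturbation stage: the Euler part of the new stress (Prop. 5.13, `R̊^E`)

L. De Rosa, *Infinitely many Leray–Hopf solutions for the fractional Navier–Stokes equations*,
Comm. PDE 44 (2019) = arXiv:1801.10235, Prop. 5.13: the new Reynolds stress is `R̊^E + R̊^D`, and for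
the Euler part "the estimate on `R̊^E_{q+1}` … can be found in [BDLSV2017]" — Buckmaster–De Lellis–
Székelyhidi–Vicol, CPAM 72 (2019) = arXiv:1701.08678, Prop. 6.1 (6.1). This file closes PART 3 of
`DeRosa.perturbationStage_of_parts` (`DeRosaPerturbation.lean`) under the core hypotheses
`DeRosa.CoreHypotheses`:

* the Core-hypotheses transcriptions `DeRosa.stressEstimate` (BDSV Prop. 6.1 (6.1)) and
  `DeRosa.transportErrorEstimate` (§6.1.2, arXiv (6.8)) — the twins of `BDSV.stressEstimate`,
  `BDSV.transportErrorEstimate` with `BDSV.PerturbationHypotheses` replaced by `DeRosa.CoreHypotheses`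
  — both PROVED here: `transportErrorEstimate_holds` is `DeRosa.transportError_stageFact`
  (`DeRosaPertTransportErrorProof.lean`, the Calderón–Zygmund route of the curl form, which the tree's
  BDSV files had left open), and `stressEstimate_holds` assembles it with the ported Nash and
  oscillation errors (`DeRosaPertStressErrors.lean`) exactly as `BDSV.stressEstimate_of_errors` (§6.1.4);
* `DeRosa.euler_stress_part`: part 3 of the assembly.

## References

* L. De Rosa, Comm. PDE 44 (2019) 335–365 = arXiv:1801.10235, §5.5 Prop. 5.13 (the term `R̊^E`).
* T. Buckmaster, C. De Lellis, L. Székelyhidi Jr., V. Vicol, CPAM 72 (2019) = arXiv:1701.08678,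
  Prop. 6.1 (6.1), §6.1.2 (arXiv (6.8)), §6.1.4.
-/

open MeasureTheory Set
open scoped NNReal ENNReal ContDiff Matrix Matrix.Norms.Elementwise

noncomputable section

namespace Literature.Analysis.FluidPDE

/-! ## Port of `OnsagerBDSVPerturbation` -/

namespace DeRosa

open BDSV

open FunctionSpaces FunctionSpaces.Torus

/-- The flat three-torus `T³ = (ℝ/ℤ)³`, local notation. -/
local notation "𝕋³" => UnitAddTorus (Fin 3)

/-- Euclidean `ℝ³`, local notation. -/
local notation "ℝ³" => EuclideanSpace ℝ (Fin 3)

/-- Real `3 × 3` matrices, local notation. -/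
local notation "𝕄" => Matrix (Fin 3) (Fin 3) ℝ

section Facts

/-- **The Reynolds stress estimate** (BDSV Prop. 6.1, (6.1): "The Reynolds stress error `R̊_{q+1}`
defined in (5.23) satisfies `‖R̊_{q+1}‖₀ ≲ δ_{q+1}^{1/2} δ_q^{1/2} λ_q / λ_{q+1}^{1-4α}`", the
implicit constant depending on `β, α, M`, the number `N` of derivatives chosen in §6.1.1 and the
constants of the standing estimates, for `a` sufficiently large; the proof is §6.1 — Nash,
transport and oscillation errors, each through the stationary phase estimate Prop. C.2 for `ℛ`).
Transcription: same prefix as `BDSV.incrementEstimate`, with `∃ N̄` (§6.1.1: "`N` large enough")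
and an explicit constant `C` fixed before `a₀`; `‖·‖₀` by `BDSV.SupLE`.
[cite: BuckmasterEtAl2018, Prop. 6.1 (6.1)] -/
def stressEstimate : Prop :=
  ∀ (𝔚 : MikadoDatum mikadoRadius) (c₀ : ℝ), 0 < c₀ → ∀ Cη : ℕ → ℕ → ℝ,
    ∀ β : ℝ, 0 < β → β < 1 / 3 → ∀ b : ℝ, 1 < b → b < (1 - β) / (2 * β) →
      ∃ α₀ : ℝ, 0 < α₀ ∧ ∀ α : ℝ, 0 < α → α < α₀ → ∃ Nbar : ℕ, ∀ Cin C₀ : ℝ,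
        ∃ C a₀ : ℝ, 1 < a₀ ∧ ∀ a : ℝ, a₀ ≤ a → ∀ S : Setting,
          CoreHypotheses ⟨β, α, a, b⟩ S Nbar Cin C₀ →
            ∀ 𝒟 : PerturbationData ⟨β, α, a, b⟩ S c₀ Cη,
              SupLE S.T (BDSV.newStress ⟨β, α, a, b⟩ S 𝔚 𝒟.cut.η 𝒟.D)
                (C * (Real.sqrt (amp β a b (S.q + 1)) * Real.sqrt (amp β a b S.q) *
                  freq a b S.q * freq a b (S.q + 1) ^ (-1 + 4 * α)))

end Facts

end DeRosa

/-! ## Port of `OnsagerBDSVStressSplit` -/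

namespace DeRosa

open BDSV

open FunctionSpaces FunctionSpaces.Torus

/-- The flat three-torus `T³ = (ℝ/ℤ)³`, local notation. -/
local notation "𝕋³" => UnitAddTorus (Fin 3)

/-- Euclidean `ℝ³`, local notation. -/
local notation "ℝ³" => EuclideanSpace ℝ (Fin 3)

section Facts

/-- **The transport error estimate** (BDSV §6.1.2, concluding display, arXiv (6.8): "summing
over `k ≠ 0` we reach the inequality
`‖ℛ(∂ₜw_{q+1} + v̄_q·∇w_{q+1})‖_α ≲ δ_{q+1}^{1/2} δ_q^{1/2} λ_q / λ_{q+1}^{1-3α}`"; proof: the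
Lie-advection identity arXiv (5.18) gives arXiv (6.6), whose modes `(∇v̄_q)ᵀ∇Φ_i⁻¹ b_{i,k}`,
`d_{i,k}` and `D_{t,q} c_{i,k}` are fed to Prop. C.2 (arXiv (6.7)) with Props. 5.7, 5.9, using
`τ_q^{-1} = δ_q^{1/2} λ_q ℓ^{-2α}`, `ℓ^{-2α} ≤ λ_q^{3α} ≤ λ_{q+1}^{3α}` and arXiv (6.4) — the
display for the `d_{i,k}` term ends with `λ_{q+1}^{-(1-4α)}`). Transcription as in
`BDSV.nashErrorEstimate`, with the power `λ_{q+1}^{-(1-4α)}` of (6.1) (implied by the printed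
`λ_{q+1}^{-(1-3α)}`); the transport term is `BDSV.transportSource` (one-sided time derivative
within `[0,T]`). [cite: BuckmasterEtAl2018, §6.1.2 (arXiv (6.8)) with Prop. 6.1 (6.1)] -/
def transportErrorEstimate : Prop :=
  ∀ (𝔚 : MikadoDatum mikadoRadius) (c₀ : ℝ), 0 < c₀ → ∀ Cη : ℕ → ℕ → ℝ,
    ∀ β : ℝ, 0 < β → β < 1 / 3 → ∀ b : ℝ, 1 < b → b < (1 - β) / (2 * β) →
      ∃ α₀ : ℝ, 0 < α₀ ∧ ∀ α : ℝ, 0 < α → α < α₀ → ∃ Nbar : ℕ, ∀ Cin C₀ : ℝ,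
        ∃ C a₀ : ℝ, 1 < a₀ ∧ ∀ a : ℝ, a₀ ≤ a → ∀ S : Setting,
          CoreHypotheses ⟨β, α, a, b⟩ S Nbar Cin C₀ →
            ∀ 𝒟 : PerturbationData ⟨β, α, a, b⟩ S c₀ Cη,
              HolderSupLE S.T
                (fun t => Torus.antidivergence (transportSource ⟨β, α, a, b⟩ S 𝔚 𝒟.cut.η 𝒟.D t))
                0 (Real.toNNReal α)
                (C * (Real.sqrt (amp β a b (S.q + 1)) * Real.sqrt (amp β a b S.q) *
                  freq a b S.q * freq a b (S.q + 1) ^ (-1 + 4 * α)))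

end Facts

section Assembly

/-- **Assembly of Prop. 6.1 from the three error estimates** (BDSV §6.1.4: "Clearly (6.1)
follows from (6.5), (6.8), (6.12) and (5.21)", arXiv numbering): the Nash, transport and
oscillation estimates imply the stress estimate (6.1), `BDSV.stressEstimate`. The thresholds are
the extremal ones of the three facts together with `α < βb(b-1)` and the threshold of
`BDSV.exists_threshold_amp_succ_succ` (which make `ρ_q > 0`, so that the construction is smooth
and `ℛ` splits the new stress into its three terms); the constant is `Σ_j max(C_j, 0)`, using
`‖f(x)‖ ≤ ‖f‖_α`. [cite: BuckmasterEtAl2018, §6.1.4] -/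
theorem stressEstimate_of_errors (hN : nashErrorEstimate) (hT : transportErrorEstimate)
    (hO : oscillationErrorEstimate) : stressEstimate := by
  intro 𝔚 c₀ hc₀ Cη β hβ hβ' b hb hb'
  obtain ⟨αN, hαN, hN⟩ := hN 𝔚 c₀ hc₀ Cη β hβ hβ' b hb hb'
  obtain ⟨αT, hαT, hT⟩ := hT 𝔚 c₀ hc₀ Cη β hβ hβ' b hb hb'
  obtain ⟨αO, hαO, hO⟩ := hO 𝔚 c₀ hc₀ Cη β hβ hβ' b hb hb'
  have hαρ : 0 < β * b * (b - 1) := mul_pos (mul_pos hβ (by linarith)) (by linarith)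
  refine ⟨min (min αN αT) (min αO (β * b * (b - 1))),
    lt_min (lt_min hαN hαT) (lt_min hαO hαρ), ?_⟩
  intro α hα hαlt
  have hα1 : α < min αN αT := lt_of_lt_of_le hαlt (min_le_left _ _)
  have hα2 : α < min αO (β * b * (b - 1)) := lt_of_lt_of_le hαlt (min_le_right _ _)
  have hαρ' : α < 2 * β * b * (b - 1) := by
    have := lt_of_lt_of_le hα2 (min_le_right _ _)
    nlinarith
  obtain ⟨NN, hN⟩ := hN α hα (lt_of_lt_of_le hα1 (min_le_left _ _))
  obtain ⟨NT, hT⟩ := hT α hα (lt_of_lt_of_le hα1 (min_le_right _ _))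
  obtain ⟨NO, hO⟩ := hO α hα (lt_of_lt_of_le hα2 (min_le_left _ _))
  refine ⟨max (max NN NT) NO, ?_⟩
  intro Cin C₀
  obtain ⟨CN, aN, haN, hN⟩ := hN Cin C₀
  obtain ⟨CT, aT, haT, hT⟩ := hT Cin C₀
  obtain ⟨CO, aO, haO, hO⟩ := hO Cin C₀
  obtain ⟨aρ, haρ, hρ⟩ := exists_threshold_amp_succ_succ hb hαρ'
  refine ⟨max CN 0 + max CT 0 + max CO 0, max (max aN aT) (max aO aρ),
    lt_max_of_lt_left (lt_max_of_lt_left haN), ?_⟩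
  intro a ha S H 𝒟
  have ha1' : max aN aT ≤ a := le_trans (le_max_left _ _) ha
  have ha2' : max aO aρ ≤ a := le_trans (le_max_right _ _) ha
  have haN' : aN ≤ a := le_trans (le_max_left _ _) ha1'
  have haT' : aT ≤ a := le_trans (le_max_right _ _) ha1'
  have haO' : aO ≤ a := le_trans (le_max_left _ _) ha2'
  have haρ'' : aρ ≤ a := le_trans (le_max_right _ _) ha2'
  have ha1 : (1 : ℝ) ≤ a := le_trans haN.le haN'
  -- the three estimates for these data
  have eN := hN a haN' S (H.of_le (le_trans (le_max_left _ _) (le_max_left _ _))) 𝒟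
  have eT := hT a haT' S (H.of_le (le_trans (le_max_right _ _) (le_max_left _ _))) 𝒟
  have eO := hO a haO' S (H.of_le (le_max_right _ _)) 𝒟
  -- smoothness, hence the split of `ℛ F`
  have hsm : SmoothData ⟨β, α, a, b⟩ S 𝒟.cut.η 𝒟.D := H.smoothData ha1 (hρ a haρ'' S.q) hc₀ 𝒟
  have hs := stressScale_nonneg (β := β) (α := α) (b := b) ha1 S.q
  intro t ht x
  rw [hsm.newStress_eq_sum 𝔚 ht x]
  have bT := (eT.norm_le ht x).trans (max_mul_le_max_mul hs)
  have bN := (eN.norm_le ht x).trans (max_mul_le_max_mul hs)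
  have bO := (eO.norm_le ht x).trans (max_mul_le_max_mul hs)
  calc _ ≤ _ := norm_add₃_le
    _ ≤ max CT 0 * _ + max CN 0 * _ + max CO 0 * _ := add_le_add (add_le_add bT bN) bO
    _ = _ := by ring

/-- **The transport error estimate holds under the core hypotheses** (BDSV §6.1.2, arXiv (6.8);
De Rosa Prop. 5.13 for `R̊^E`): `DeRosa.transportErrorEstimate` is, definitionally, the stage fact with
the transport-error body, proved in `DeRosaPertTransportErrorProof.lean` by the Calderón–Zygmund route.
[cite: BuckmasterEtAl2018, §6.1.2 (arXiv (6.8)); Derosa2018 Prop. 5.13] -/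
theorem transportErrorEstimate_holds : transportErrorEstimate := transportError_stageFact

/-- **BDSV Prop. 6.1 (6.1) under the core hypotheses** (De Rosa Prop. 5.13, the term `R̊^E`:
"the estimate … can be found in [BDLSV2017]"): from the Nash, transport and oscillation errors.
[cite: BuckmasterEtAl2018, Prop. 6.1 (6.1) and §6.1.4; Derosa2018 Prop. 5.13 (R̊^E)] -/
theorem stressEstimate_holds : stressEstimate :=
  stressEstimate_of_errors nashErrorEstimate_holds transportErrorEstimate_holds oscillationErrorEstimate_holds

/-- **Part 3 of `DeRosa.perturbationStage_of_parts`** (the Euler part `R̊^E` of the new stress,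
De Rosa Prop. 5.13 = BDSV Prop. 6.1 (6.1), under the core hypotheses).
[cite: Derosa2018, §5.5 Prop. 5.13 (the term R̊^E); BuckmasterEtAl2018, Prop. 6.1 (6.1)] -/
theorem euler_stress_part (𝔚 : MikadoDatum mikadoRadius) (c₀ : ℝ) (hc₀ : 0 < c₀) (Cη : ℕ → ℕ → ℝ) :
    eulerStressPart 𝔚 c₀ Cη :=
  stressEstimate_holds 𝔚 c₀ hc₀ Cη

end Assembly

end DeRosa

end Literature.Analysis.FluidPDE
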